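/-
Copyright (c) 2026 the pub-hodgecm-mathlib formalisation cell (harness21).  Prover seat hodgecm-mathlib-K2E1-p16 (g2), Track B ∕ K2-LIT, h413 = `stmt-HodgeConjecture-24833`,
route of record `HCCMUnconditional`; R90-TF section S8 «ContSpec-n½» (dealer R90-CS-plan (g0), LEAD K2E1-plan (g7)), «U(Φ₃) χ-TWIN row 7c» (TWIN-DAG v1 §A row 7c): the N = 3 twin of ★
`K2E1ChiScatteringCoordsHolomorphicCMTwo` (K2E1-p14) — INDEX-FREE (span hypothesis `hsp`; the pair-basis corollary waits for `chiSectionSpacePair`, D-S8-3 ED.2).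
-/
import Summits.HodgeConjecture.HodgeConjecture.Theorems.K2E1ChiScatteringCoordsHolomorphicCMTwo   -- ★ (K2E1-p14): GENERIC §1 `differentiableOn_integral_mul_ofReal_cpow`; brings ★ `exists_coords_differentiableOn`, ★ `re_mem_Icc_of_mem_ball`
import Summits.HodgeConjecture.HodgeConjecture.Theorems.K2E1IntertwinedCoeffContinuousCM             -- ★ (the `U(J₃)` file): `integrable_borelHeight_weylLongU_mul_rpow_cm_three` (Godement at N = 3, `2 < σ`)
import Summits.HodgeConjecture.HodgeConjecture.Theorems.K2E1HeisenbergHaarU3                        -- ★ `isInvInvariant_of_isHaarMeasure_adelicUnipotent_three` (the Heisenberg `N(𝔸)` is unimodular)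
import HarnessLib

/-!
# S8 «U(Φ₃) χ-TWIN» row 7c — `K2E1ChiScatteringCoordsHolomorphicCMThree`: THE SCATTERING COORDINATES OF `U(2,1)_{L∕L⁺}` ARE HOLOMORPHIC ON `{2 < Re}` — the intertwining integral
# `z ↦ ∫_{N(𝔸)} f_z^φ(w₀ v g) dν`, the intertwined coefficient `φ̃_z(g) = (∫ …)·H(g)^{z−2}`, and the coordinates of `(ν𝓕)⁻¹·φ̃_z` in any finite linearly independent family spanning the `φ̃_z`
# (the N = 3 twin of ★ `K2E1ChiScatteringCoordsHolomorphicCMTwo`)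

Cell `pub/hodgecm-mathlib`, crux H413 = `stmt-HodgeConjecture-24833`; R90-TF section S8.  THEOREMS ONLY (no `def`, no `instance`, no notation, no named-fact hypothesis, no `sorry`); lane
`--supports stmt-HodgeConjecture-24833 --as helper` (count-neutral).  Closes no socket.  INDEX-FREE (RULING S8-R10 (a)): the section `φ` enters through continuity + a bound only; the
cuspidal datum enters through the span hypothesis `hsp` (for the pair currency: `hsp` from ★ row 4a `isChiSectionPair_intertwinedCoeff_three` + ★ row 4b `intertwinedCoeff_mul_right_of_rightLaw`
once `chiSectionSpacePair` is ★ — the basis corollary `exists_scatteringCoords_of_basis_cm_three` is that 10-line ED.2, not typed here).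
THE MATHEMATICS ([BernsteinLapid2019, §4 p. 10, §7]; [MoeglinWaldspurger1995, II.1.6–II.1.7]) — verbatim the N = 2 original with the N = 3 exponents: Godement range `2 < Re z`
(★ `integrable_borelHeight_weylLongU_mul_rpow_cm_three`), normalisation `H^{z−2}`; the Haar measure of the Heisenberg `N(𝔸)` is inversion-invariant (★ `isInvInvariant_of_isHaarMeasure_adelicUnipotent_three`).
* §2 **`differentiableOn_intertwiningIntegral_cm_three`**, **`differentiableOn_intertwinedCoeff_apply_cm_three`**.  * §3 HEAD **`exists_scatteringCoords_cm_three`** (letters `(q) (hq) (hqφ)` of X2_χ at N = 3).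
HONEST LABEL: HC_CM is proved only modulo the 7 printed citations (2 remaining named inputs: hLiu418 = `stmt-HodgeConjecture-24832`, h413 = `stmt-HodgeConjecture-24833`) until rung 0
closes; count-neutral helper, closes no socket.

## References
* [BernsteinLapid2019] J. Bernstein, E. Lapid, *On the meromorphic continuation of Eisenstein series*, J. AMS 37 (2024), §4 (p. 10), §7.
* [MoeglinWaldspurger1995] C. Mœglin, J.-L. Waldspurger, *Spectral Decomposition and Eisenstein Series* (1995), II.1.6–II.1.7.
-/

set_option autoImplicit false
set_option linter.dupNamespace false  -- the mandated namespace repeats the summit's segment (`HodgeConjecture.HodgeConjecture`)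

noncomputable section

open MeasureTheory Measure Filter Topology Set NumberField Metric
open scoped NNReal ENNReal
open Literature.NumberTheory Literature.NumberTheory.Automorphic Literature.NumberTheory.Automorphic.UnitaryGroup AdelicGroupData
open Literature.NumberTheory.GaloisRepresentations (HeckeCharacter)
open Summit.HodgeConjecture.HodgeConjecture.Cruxes.H413.K2E1BorelEisensteinU
open Summit.HodgeConjecture.HodgeConjecture.Cruxes.H413.K2E1CharacterEisensteinU2Defs
open Summit.HodgeConjecture.HodgeConjecture.Cruxes.H413.K2E1LinearIndependentEvalMatrix (exists_coords_differentiableOn)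
open Summit.HodgeConjecture.HodgeConjecture.Cruxes.H413.K2E1ChiScatteringCoordsHolomorphicCMTwo (differentiableOn_integral_mul_ofReal_cpow)
open Summit.HodgeConjecture.HodgeConjecture.Cruxes.H413.K2E1IntertwinedCoeffContinuousCM (integrable_borelHeight_weylLongU_mul_rpow_cm_three)
open Summit.HodgeConjecture.HodgeConjecture.Cruxes.H413.K2E1HeisenbergHaarU3 (isInvInvariant_of_isHaarMeasure_adelicUnipotent_three)
open Summit.HodgeConjecture.HodgeConjecture.Cruxes.H413.K2E1PowerMomentHolomorphy (re_mem_Icc_of_mem_ball)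

namespace Summit.HodgeConjecture.HodgeConjecture.Cruxes.H413.K2E1ChiScatteringCoordsHolomorphicCMThree

/-! ## §2–§3 (CM pair, `N = 3`) -/

section CM

variable (L : Type) [Field L] [NumberField L] [IsCMField L]
  [MeasurableSpace (quasiSplit (↥(maximalRealSubfield L)) L (IsCMField.complexConj L) 3).Adelic] [BorelSpace (quasiSplit (↥(maximalRealSubfield L)) L (IsCMField.complexConj L) 3).Adelic]

/-- **THE INTERTWINING INTEGRAL `z ↦ ∫_{N(𝔸)} f_z^φ(w₀ v g) dν` IS HOLOMORPHIC ON `{2 < Re}`** for continuous bounded `φ` (`f_z^φ(x) = φ(x)·H(x)^z`, §1 with Godement's ★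
`integrable_borelHeight_weylLongU_mul_rpow_cm_three`). [cite: MoeglinWaldspurger1995, II.1.6–II.1.7] -/
theorem differentiableOn_intertwiningIntegral_cm_three (ν : Measure ↥(adelicUnipotent (↥(maximalRealSubfield L)) L (IsCMField.complexConj L) 3)) [ν.IsHaarMeasure]
    {𝓕 : Set ↥(adelicUnipotent (↥(maximalRealSubfield L)) L (IsCMField.complexConj L) 3)} (h𝓕N : IsFundamentalDomain ↥(rationalUnipotent (↥(maximalRealSubfield L)) L (IsCMField.complexConj L) 3) 𝓕 ν) (h𝓕c : IsCompact (closure 𝓕))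
    {φ : (quasiSplit (↥(maximalRealSubfield L)) L (IsCMField.complexConj L) 3).Adelic → ℂ} (hφc : Continuous φ) {Mφ : ℝ} (hφM : ∀ x, ‖φ x‖ ≤ Mφ) (g : (quasiSplit (↥(maximalRealSubfield L)) L (IsCMField.complexConj L) 3).Adelic) :
    DifferentiableOn ℂ (fun z : ℂ => ∫ v : ↥(adelicUnipotent (↥(maximalRealSubfield L)) L (IsCMField.complexConj L) 3), flatSectionU φ z ((quasiSplit (↥(maximalRealSubfield L)) L (IsCMField.complexConj L) 3).toAdelic (weylLongU ((IsCMField.complexConj L : L ≃ₐ[↥(maximalRealSubfield L)] L) : L →+* L) (rfl : (StdForm.antidiagonal 3).over L = (StdForm.antidiagonal 3).over L)) * ((v : (quasiSplit (↥(maximalRealSubfield L)) L (IsCMField.complexConj L) 3).Adelic) * g)) ∂ν) {z : ℂ | 2 < z.re} := by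
  haveI : LocallyCompactSpace (AdeleRing (𝓞 L) L) := locallyCompactSpace_adeleRing' L
  haveI := isInvInvariant_of_isHaarMeasure_adelicUnipotent_three (F := ↥(maximalRealSubfield L)) (E := L) (c := IsCMField.complexConj L)
    (AlgEquiv.ext fun x => by rw [AlgEquiv.mul_apply, AlgEquiv.one_apply, IsCMField.complexConj_apply_apply]) ν
  have hcont : Continuous fun v : ↥(adelicUnipotent (↥(maximalRealSubfield L)) L (IsCMField.complexConj L) 3) => (quasiSplit (↥(maximalRealSubfield L)) L (IsCMField.complexConj L) 3).toAdelic (weylLongU ((IsCMField.complexConj L : L ≃ₐ[↥(maximalRealSubfield L)] L) : L →+* L) (rfl : (StdForm.antidiagonal 3).over L = (StdForm.antidiagonal 3).over L)) * ((v : (quasiSplit (↥(maximalRealSubfield L)) L (IsCMField.complexConj L) 3).Adelic) * g) := continuous_const.mul (continuous_subtype_val.mul continuous_const)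
  have hmeas : Measurable fun v : ↥(adelicUnipotent (↥(maximalRealSubfield L)) L (IsCMField.complexConj L) 3) => ((borelHeight ((quasiSplit (↥(maximalRealSubfield L)) L (IsCMField.complexConj L) 3).toAdelic (weylLongU ((IsCMField.complexConj L : L ≃ₐ[↥(maximalRealSubfield L)] L) : L →+* L) (rfl : (StdForm.antidiagonal 3).over L = (StdForm.antidiagonal 3).over L)) * ((v : (quasiSplit (↥(maximalRealSubfield L)) L (IsCMField.complexConj L) 3).Adelic) * g)) : ℝ≥0) : ℝ) := (NNReal.continuous_coe.comp (continuous_borelHeight.comp hcont)).measurable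
  have hcf : Measurable fun v : ↥(adelicUnipotent (↥(maximalRealSubfield L)) L (IsCMField.complexConj L) 3) => φ ((quasiSplit (↥(maximalRealSubfield L)) L (IsCMField.complexConj L) 3).toAdelic (weylLongU ((IsCMField.complexConj L : L ≃ₐ[↥(maximalRealSubfield L)] L) : L →+* L) (rfl : (StdForm.antidiagonal 3).over L = (StdForm.antidiagonal 3).over L)) * ((v : (quasiSplit (↥(maximalRealSubfield L)) L (IsCMField.complexConj L) 3).Adelic) * g)) := (hφc.comp hcont).measurable
  have h := differentiableOn_integral_mul_ofReal_cpow hcf hmeas (fun v => NNReal.coe_pos.2 (borelHeight_pos _)) (fun v => hφM _) (a := 2)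
    fun σ hσ => integrable_borelHeight_weylLongU_mul_rpow_cm_three L ν h𝓕N h𝓕c hσ g
  exact h.congr fun z _ => by simp only [flatSectionU_apply]

/-- **THE INTERTWINED COEFFICIENT `z ↦ φ̃_z(g) = (∫_{N(𝔸)} f_z^φ(w₀ v g) dν)·H(g)^{z−2}` IS HOLOMORPHIC ON `{2 < Re}`** for every `g`. [cite: MoeglinWaldspurger1995, II.1.7] -/
theorem differentiableOn_intertwinedCoeff_apply_cm_three (ν : Measure ↥(adelicUnipotent (↥(maximalRealSubfield L)) L (IsCMField.complexConj L) 3)) [ν.IsHaarMeasure]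
    {𝓕 : Set ↥(adelicUnipotent (↥(maximalRealSubfield L)) L (IsCMField.complexConj L) 3)} (h𝓕N : IsFundamentalDomain ↥(rationalUnipotent (↥(maximalRealSubfield L)) L (IsCMField.complexConj L) 3) 𝓕 ν) (h𝓕c : IsCompact (closure 𝓕))
    {φ : (quasiSplit (↥(maximalRealSubfield L)) L (IsCMField.complexConj L) 3).Adelic → ℂ} (hφc : Continuous φ) {Mφ : ℝ} (hφM : ∀ x, ‖φ x‖ ≤ Mφ) (g : (quasiSplit (↥(maximalRealSubfield L)) L (IsCMField.complexConj L) 3).Adelic) :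
    DifferentiableOn ℂ (fun z : ℂ => (fun g : (quasiSplit (↥(maximalRealSubfield L)) L (IsCMField.complexConj L) 3).Adelic => (∫ v : ↥(adelicUnipotent (↥(maximalRealSubfield L)) L (IsCMField.complexConj L) 3), flatSectionU φ z ((quasiSplit (↥(maximalRealSubfield L)) L (IsCMField.complexConj L) 3).toAdelic (weylLongU ((IsCMField.complexConj L : L ≃ₐ[↥(maximalRealSubfield L)] L) : L →+* L) (rfl : (StdForm.antidiagonal 3).over L = (StdForm.antidiagonal 3).over L)) * ((v : (quasiSplit (↥(maximalRealSubfield L)) L (IsCMField.complexConj L) 3).Adelic) * g)) ∂ν) * (((borelHeight g : ℝ) : ℂ) ^ (z - 2))) g) {z : ℂ | 2 < z.re} := by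
  have hH : (((borelHeight g : ℝ≥0) : ℝ) : ℂ) ≠ 0 := Complex.ofReal_ne_zero.2 (NNReal.coe_pos.2 (borelHeight_pos g)).ne'
  exact (differentiableOn_intertwiningIntegral_cm_three L ν h𝓕N h𝓕c hφc hφM g).mul fun z _ => ((differentiableAt_id.sub_const (2 : ℂ)).const_cpow (Or.inl hH)).differentiableWithinAt

/-- **HEAD — THE SCATTERING COORDINATES ARE HOLOMORPHIC ON `{2 < Re}`**: for continuous bounded `φ` and a linearly independent finite family `φ′_j` whose span contains every `φ̃_z`
(`1 < Re z`), there are `q_j` holomorphic on `{2 < Re}` with `Σ_j q_j(z) φ′_j = (ν𝓕)⁻¹·φ̃_z` — the letters `(q) (hq) (hqφ)` of ★ `chiEisenstein_meromorphic_exports_cm_two_of_letters` read at N = 3 (twin row 6∕8).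
[cite: BernsteinLapid2019, §4 p. 10, §7] [cite: MoeglinWaldspurger1995, II.1.7] -/
theorem exists_scatteringCoords_cm_three (ν : Measure ↥(adelicUnipotent (↥(maximalRealSubfield L)) L (IsCMField.complexConj L) 3)) [ν.IsHaarMeasure]
    {𝓕 : Set ↥(adelicUnipotent (↥(maximalRealSubfield L)) L (IsCMField.complexConj L) 3)} (h𝓕N : IsFundamentalDomain ↥(rationalUnipotent (↥(maximalRealSubfield L)) L (IsCMField.complexConj L) 3) 𝓕 ν) (h𝓕c : IsCompact (closure 𝓕))
    {φ : (quasiSplit (↥(maximalRealSubfield L)) L (IsCMField.complexConj L) 3).Adelic → ℂ} (hφc : Continuous φ) {Mφ : ℝ} (hφM : ∀ x, ‖φ x‖ ≤ Mφ)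
    {ι' : Type} [Fintype ι'] [DecidableEq ι'] {φ' : ι' → (quasiSplit (↥(maximalRealSubfield L)) L (IsCMField.complexConj L) 3).Adelic → ℂ} (hli : LinearIndependent ℂ φ')
    (hsp : ∀ z : ℂ, 2 < z.re → (fun g : (quasiSplit (↥(maximalRealSubfield L)) L (IsCMField.complexConj L) 3).Adelic => (∫ v : ↥(adelicUnipotent (↥(maximalRealSubfield L)) L (IsCMField.complexConj L) 3), flatSectionU φ z ((quasiSplit (↥(maximalRealSubfield L)) L (IsCMField.complexConj L) 3).toAdelic (weylLongU ((IsCMField.complexConj L : L ≃ₐ[↥(maximalRealSubfield L)] L) : L →+* L) (rfl : (StdForm.antidiagonal 3).over L = (StdForm.antidiagonal 3).over L)) * ((v : (quasiSplit (↥(maximalRealSubfield L)) L (IsCMField.complexConj L) 3).Adelic) * g)) ∂ν) * (((borelHeight g : ℝ) : ℂ) ^ (z - 2))) ∈ Submodule.span ℂ (Set.range φ')) :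
    ∃ q : ι' → ℂ → ℂ, (∀ j, DifferentiableOn ℂ (q j) {z : ℂ | 2 < z.re}) ∧ ∀ z : ℂ, 2 < z.re → (∑ j, q j z • φ' j) = ((((ν 𝓕).toReal⁻¹ : ℝ)) : ℂ) • (fun g : (quasiSplit (↥(maximalRealSubfield L)) L (IsCMField.complexConj L) 3).Adelic => (∫ v : ↥(adelicUnipotent (↥(maximalRealSubfield L)) L (IsCMField.complexConj L) 3), flatSectionU φ z ((quasiSplit (↥(maximalRealSubfield L)) L (IsCMField.complexConj L) 3).toAdelic (weylLongU ((IsCMField.complexConj L : L ≃ₐ[↥(maximalRealSubfield L)] L) : L →+* L) (rfl : (StdForm.antidiagonal 3).over L = (StdForm.antidiagonal 3).over L)) * ((v : (quasiSplit (↥(maximalRealSubfield L)) L (IsCMField.complexConj L) 3).Adelic) * g)) ∂ν) * (((borelHeight g : ℝ) : ℂ) ^ (z - 2))) :=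
  exists_coords_differentiableOn hli (S := {z : ℂ | 2 < z.re}) (v := fun z => ((((ν 𝓕).toReal⁻¹ : ℝ)) : ℂ) • (fun g : (quasiSplit (↥(maximalRealSubfield L)) L (IsCMField.complexConj L) 3).Adelic => (∫ v : ↥(adelicUnipotent (↥(maximalRealSubfield L)) L (IsCMField.complexConj L) 3), flatSectionU φ z ((quasiSplit (↥(maximalRealSubfield L)) L (IsCMField.complexConj L) 3).toAdelic (weylLongU ((IsCMField.complexConj L : L ≃ₐ[↥(maximalRealSubfield L)] L) : L →+* L) (rfl : (StdForm.antidiagonal 3).over L = (StdForm.antidiagonal 3).over L)) * ((v : (quasiSplit (↥(maximalRealSubfield L)) L (IsCMField.complexConj L) 3).Adelic) * g)) ∂ν) * (((borelHeight g : ℝ) : ℂ) ^ (z - 2)))) (fun z hz => Submodule.smul_mem _ _ (hsp z hz))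
    fun x => ((differentiableOn_intertwinedCoeff_apply_cm_three L ν h𝓕N h𝓕c hφc hφM x).const_mul ((((ν 𝓕).toReal⁻¹ : ℝ)) : ℂ)).congr fun z _ => by simp only [Pi.smul_apply, smul_eq_mul]

end CM

end Summit.HodgeConjecture.HodgeConjecture.Cruxes.H413.K2E1ChiScatteringCoordsHolomorphicCMThree

end
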